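import Mathlib
import Summits.Ventures.FusionMHD.Models.RwmFRS1Kq78Profile
import Literature.MathematicalPhysics.MHD.NewcombAxisymmetricModes
import HarnessLib

/-!
# F3 rider «AXISYMMETRIC (m = 0) INTERNAL MODES BY NEWCOMB'S k → 0 TEST» for MODEL M_RWM,78 — every admissible `m = 0` internal
# displacement has positive reduced energy for every `k ≠ 0`, certified by lit-4's quadratic Sturm majorant (no numerical solve)

LADDER-GRIDFUSION rung F3 (cell `gridfusion`, lead g10 RULING 9dl (3) «F3.σ-NEWCOMB-m0-RWM», producer gridfusion-model-7 g7, 2026-08-28; lit-4 g10's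
recipe INBOX 00:08Z/00:17Z).  THE PRINTED TEST: Miyamoto §9.3c(ii) / Freidberg §11.5.3 — all modes are stable iff the modes `m = 0, k → 0` and `m = 1` are;
the `m = 0`, `k → 0` functional is `∫₀ᵃ (rB_z²ξ′² + (B_z²/r + 2μ₀p′)ξ²)` (lit-4's `fluidEnergyAxisymLimit`), positive on the admissible class as soon as a
positive supersolution exists: `Literature/…/NewcombAxisymmetricModes.fluidEnergyAxisymLimit_pos_of_sqSupersolution` (p588308) with `w = 1 − λr²`.
THIS FILE (MODEL M_RWM,78 (`Kq78.P78`, force-balanced `q₀ = 7/8`: `μ₀ = 1`, `B_z ≡ 1`, `p = 32/(1225(1+r²)²) − 8/1225 + 4/30625`); `a = 1`, `b = 51/50`):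
**`axisym_m0_line`** — for every `ξ ∈ C¹(−51/50, 51/50)` with `ξ(1) = 0`, `ξ ≢ 0` on `[0, 1]` and integrable limit density, `0 < fluidEnergyAxisymLimit 1 ξ`
(`λ = 32 / 1225` (the positive quadratic Sturm majorant `w = 1 − λr²` absorbs the pressure gradient: `4λ = 128/1225·(…)` matches `−p′/r` at the axis)); **`internal_stable_m0`** — hence for every `k ≠ 0` the reduced energy `fluidEnergy 0 k 1 ξ` (Freidberg (11.97)) of every such `ξ` with integrable
densities is POSITIVE (`ScrewPinch.Profile.fluidEnergy_mode_zero_pos_of_limit`).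
THREE COLUMNS.  CERTIFIED: the two theorems (kernel, this file + imports, axioms standard).  VALIDATED: nothing.  MODELLED: straight circular-cylinder screw pinch,
ideal MHD, internal modes, reduced energy (11.97) without vacuum factor, `B_z ≠ 0` on `[0, a]`; the `m = 0` INTERNAL verdict of THIS MODEL only — juxtaposed,
never merged, with the model's `(m, 1)` internal/external words (`RwmFRS1InternalModes`, the F3.r4 rows); nothing about a device. [instance data]
Citations: Miyamoto–Dewar 1979 §9.3c(ii) [MiyamotoDewar1979]; Freidberg 2014 §11.5.3 (11.97), (11.111) [Freidberg2014]; Hartman 1964 XI §3 [Hartman1964].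
-/

noncomputable section

open Set Literature.MathematicalPhysics.MHD Literature.MathematicalPhysics.MHD.ScrewPinch

namespace Summit.Ventures.FusionMHD.Models

namespace RwmFRS1.Kq78

/-- **NEWCOMB'S `m = 0`, `k → 0` TEST FOR THIS MODEL**: every admissible axisymmetric displacement with integrable limit density has positive limit energy
`∫₀¹ (rB_z²ξ′² + (B_z²/r + 2μ₀p′)ξ²)` — by the quadratic Sturm majorant `1 − λr²`, `λ = 32 / 1225`.
[cite: MiyamotoDewar1979, §9.3c(ii)] [cite: Freidberg2014, §11.5.3 eq. (11.111)] -/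
theorem axisym_m0_line : ∀ ξ : ℝ → ℝ, ContDiffOn ℝ 1 ξ (Ioo (-(51 / 50)) (51 / 50)) → ξ 1 = 0 → (∃ r ∈ Icc (0 : ℝ) 1, ξ r ≠ 0) →
    P78.HasIntegrableLimitDensity 1 ξ → 0 < P78.fluidEnergyAxisymLimit 1 ξ := by
  intro ξ hξ hξa hnz hfin
  obtain ⟨-, hBz, hp, -⟩ := profile_regular (51 / 50)
  refine Profile.fluidEnergyAxisymLimit_pos_of_sqSupersolution (lam := 32 / 1225) one_pos (by norm_num) hBz hp
    (fun r _ => by rw [P78_Bz]; norm_num) (by norm_num) (by norm_num) (fun r hr => ?_) hξ hξa hnz hfin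
  · -- `λ = 32 / 1225`: `−4λr ≤ p′(r)(1 − λr²)` with `p′ = −128r/(1225(1+r²)³)`, i.e. `(1 − λr²)/(1+r²)³ ≤ 1`
    have hB : P78.Bz = fun _ => (1 : ℝ) := funext P78_Bz
    rw [hB, P78_μ₀, deriv_p]
    simp only [deriv_const', one_pow, mul_one, mul_zero, sub_zero, one_mul]
    have h1 : (0 : ℝ) < (1 + r ^ 2) ^ 3 := by positivity
    have hr0 : 0 < r := hr.1
    have hle : (1 : ℝ) ≤ (1 + r ^ 2) ^ 3 := one_le_pow₀ (by nlinarith)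
    rw [show -(128 : ℝ) * r / (1225 * (1 + r ^ 2) ^ 3) * (1 - 32 / 1225 * r ^ 2)
        = -(4 * (32 / 1225) * r) * ((1 - 32 / 1225 * r ^ 2) / (1 + r ^ 2) ^ 3) by field_simp; ring]
    have hfrac : (1 - 32 / 1225 * r ^ 2) / (1 + r ^ 2) ^ 3 ≤ 1 := by
      rw [div_le_one h1]; nlinarith [sq_nonneg r]
    have h4 : 0 ≤ 4 * (32 / 1225 : ℝ) * r := by positivity
    nlinarith [hfrac, h4]

/-- **AXISYMMETRIC INTERNAL MODES OF THIS MODEL ARE STABLE FOR EVERY `k ≠ 0`**: every `ξ ∈ C¹(−51/50, 51/50)` with `ξ(1) = 0`, `ξ ≢ 0` on `[0, 1]`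
and integrable densities has `0 < fluidEnergy 0 k 1 ξ` (Freidberg (11.97); the `k²` terms are stabilising, Miyamoto §9.3c(ii)).
[cite: MiyamotoDewar1979, §9.3c(ii)] [cite: Freidberg2014, §11.5.3 eq. (11.97)] -/
theorem internal_stable_m0 {k : ℝ} (hk : k ≠ 0) : ∀ ξ : ℝ → ℝ, ContDiffOn ℝ 1 ξ (Ioo (-(51 / 50)) (51 / 50)) → ξ 1 = 0 →
    (∃ r ∈ Icc (0 : ℝ) 1, ξ r ≠ 0) → P78.HasIntegrableLimitDensity 1 ξ → P78.HasIntegrableDensity 0 k 1 ξ → 0 < P78.fluidEnergy 0 k 1 ξ :=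
  fun ξ hξ hξa hnz hfin0 hfin => P78.fluidEnergy_mode_zero_pos_of_limit hk zero_le_one ξ hfin0 hfin (axisym_m0_line ξ hξ hξa hnz hfin0)

end RwmFRS1.Kq78

end Summit.Ventures.FusionMHD.Models

end
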